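import Summits.BirchSwinnertonDyer.BirchSwinnertonDyer.Theorems.Rank2ObservatoryRootNumberCert
import Literature.NumberTheory.EllipticCurves.RootNumberTableThree
import HarnessLib

/-!
# BSD rank ≥ 2 observatory (`b2b-bsdr2`): KERNEL CERTIFICATES for the global root number of an
# integer equation INCLUDING THE PLACE `3`, modulo the tree's named fact
# `rootNumber_eq_neg_finprod_fullTableLocalRootNumberAt`

HONEST FRAMING: per-curve certified theorems and census instruments; no claim on BSD in rank ≥ 2.

Purpose: discharge, in the kernel, the hypothesis `hw : rootNumber = -1` of the cell's rank-3 census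
theorems for the `1550` census curves WITH ADDITIVE REDUCTION AT `3` — the rows the certificates
`RNCert` of `Rank2ObservatoryRootNumberCert` cannot reach (the named fact
`rootNumber_eq_neg_finprod_tableLocalRootNumberAt'` they rest on is guarded at `3`) — modulo the
tree's UNGUARDED named fact `WeierstrassCurve.rootNumber_eq_neg_finprod_fullTableLocalRootNumberAt`
(`RootNumberTableThree`: `w(E) = −∏ᵥ W.fullTableLocalRootNumberAt v`, the local root numbers read from
the corrected Kellock–Dokchitser `ℚ₂` table above `2`, from Rizzo's Table II (2003; after Halberstadt
1998; row `(≥5,6,9)` corrected) above `3`, and from Rohrlich's case list elsewhere).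

* `val3Int`, `res9Int`, `tableIIOfInt`, `w3OfInt`, `condExp3OfInt` — Rizzo's reading of Table II
  (`Rizzo.ofInvariants`: the shift `m`, the reduced triple, the prime-to-`3` parts modulo `9`) at
  INTEGER invariants with given exact `3`-adic valuations, kernel-computable; `ofInvariants_intCast`,
  `w3OfInvariants_intCast`: they agree with the `ℚ`-valued reading of the Literature file.
* `fullTableLocalRootNumberAt_eq_ite`, `finprod_fullTableLocalRootNumberAt_eq_prod` — the factors of
  the named fact and its finite product as a list product over `2`, `3` and the bad primes.
* `RNCert3` — a ROOT-NUMBER CERTIFICATE WITH THE PLACE `3`: `v₂` and `v₃` of `Δ, c₄, c₆` and one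
  `OddEntry` (of `Rank2ObservatoryRootNumberCert`) per prime `p ≥ 5` dividing `Δ`, checked by
  `OddEntry.check3`: kinds `0/1/2` as there (non-split by an Euler witness / split by a root of the
  node-tangent quadratic / additive with `ord_p c₄`, Rohrlich) plus kind `3`: additive with `c₄ = 0`
  (`j = 0`; Rohrlich's sign from `ord_p Δ` alone, `rohrlichSign p e none`); `RNCert3.check` also
  verifies `|Δ| = 2^{k₂} 3^{j} ∏ pᵉ`; `RNCert3.sign = w₂ · (w₃ · ∏ odd signs)` with `w₂ = w2OfInt …`
  (corrected `ℚ₂` table) and `w₃ = w3OfInt …` (Table II).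
* Soundness: `finprod_fullTableLocalRootNumberAt_eq_sign3` (`∏ᶠ_v W.fullTableLocalRootNumberAt v =
  c.sign` for a checking certificate) and `rootNumber_eq_neg_sign3` (`w(E) = −c.sign` GIVEN the named
  fact as a hypothesis).

Cross-checks outside the proofs (unit `b2b-bsdr2-cert-2`, gen 6): the Table II transcription agrees with
PARI/GP at `3` on all 923 952 curves of Cremona's database (`N < 5·10⁵`) additive at `3` (job `j102193`);
the Lean table agrees with an independent Python engine on all 5 522 realised input tuples.  References:
[Rizzo2003]; [Varillyalvarado2011] Rem. 4.2; [BettinDavidDelaunay2018] §4; [KellockDokchitser2023];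
[Rohrlich1993Compositio] Prop. 2; [SilvermanAEC2009] VII.
-/

set_option linter.dupNamespace false
set_option autoImplicit false

open IsDedekindDomain Rat.HeightOneSpectrum WeierstrassCurve Literature.NumberTheory.EllipticCurves
  Literature.NumberTheory.Sieve
open Literature.NumberTheory.DiophantineGeometry (KodairaSymbol)

namespace Summit.BirchSwinnertonDyer.BirchSwinnertonDyer.Rank2Observatory.RootNumber

/-! ### Rizzo's Table II at integer invariants -/

/-- `v₃ ∈ WithTop ℤ` of an integer with `3ᵏ ∥ x` (`⊤` for `0`); cf. `Rizzo.val3`. [cite: Rizzo2003, §1.1 (p. 3)] -/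
def val3Int (x : ℤ) (k : ℕ) : WithTop ℤ :=
  if x = 0 then ⊤ else ((k : ℤ) : WithTop ℤ)

/-- The prime-to-`3` part of an integer with `3ᵏ ∥ x`, modulo `9`; cf. `Rizzo.res9`. [cite: Rizzo2003, p. 2] -/
def res9Int (x : ℤ) (k : ℕ) : ℤ :=
  (x / 3 ^ k) % 9

/-- Table II read on INTEGER invariants `c₄, c₆, Δ` with their `3`-adic valuations `k₄, k₆, k_Δ`
(§1.1: shift, reduced triple, residues mod `9`; then `Rizzo.tableII`): a kernel-computable mirror of
`Rizzo.ofInvariants`. [cite: Rizzo2003, §1.1–1.2 (pp. 3–4) and Table II (p. 4)] -/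
def tableIIOfInt (c₄ c₆ Δ : ℤ) (k₄ k₆ kΔ : ℕ) : KodairaSymbol × ℕ × ℤ :=
  let m : ℤ := KellockDokchitser.shift ((kΔ : ℕ) : ℤ) (val3Int c₆ k₆) (val3Int c₄ k₄)
  Rizzo.tableII ((val3Int c₄ k₄).map fun n => n - 4 * m) ((val3Int c₆ k₆).map fun n => n - 6 * m)
    (((kΔ : ℕ) : ℤ) - 12 * m) (res9Int c₄ k₄) (res9Int c₆ k₆) (res9Int Δ kΔ)

/-- `W₃` by Table II at integer invariants (cf. `Rizzo.w3OfInvariants`). [cite: Rizzo2003, Table II (p. 4)] -/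
def w3OfInt (c₄ c₆ Δ : ℤ) (k₄ k₆ kΔ : ℕ) : ℤ :=
  (tableIIOfInt c₄ c₆ Δ k₄ k₆ kΔ).2.2

/-- `v₃(N)` by Table II at integer invariants (cf. `Rizzo.condExpOfInvariants`). [cite: Rizzo2003, Table II (p. 4)] -/
def condExp3OfInt (c₄ c₆ Δ : ℤ) (k₄ k₆ kΔ : ℕ) : ℕ :=
  (tableIIOfInt c₄ c₆ Δ k₄ k₆ kΔ).2.1

/-- `padicValRat 3` of a cast integer with `3ᵏ ∥ x` is `k`. [folklore] -/
theorem padicValRat_three_intCast_of_exactPow {k : ℕ} {x : ℤ} (h : exactPow 3 k x = true) :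
    padicValRat 3 (x : ℚ) = k := by
  haveI : Fact (3 : ℕ).Prime := ⟨Nat.prime_three⟩
  rw [padicValRat.of_int, padicValInt_of_exactPow h]

/-- `Rizzo.val3` at a cast integer. [cite: Rizzo2003, §1.1 (p. 3)] -/
theorem val3_intCast {k : ℕ} {x : ℤ} (h : x = 0 ∨ exactPow 3 k x = true) :
    Rizzo.val3 (x : ℚ) = val3Int x k := by
  unfold Rizzo.val3 val3Int
  rcases eq_or_ne x 0 with h0 | h0
  · subst h0; simp
  · rw [if_neg (by exact_mod_cast h0), if_neg h0, padicValRat_three_intCast_of_exactPow (h.resolve_left h0)]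

/-- `Rizzo.res9` at a cast integer. [cite: Rizzo2003, p. 2 (notation x')] -/
theorem res9_intCast {k : ℕ} {x : ℤ} (h : x = 0 ∨ exactPow 3 k x = true) :
    Rizzo.res9 (x : ℚ) = res9Int x k := by
  unfold Rizzo.res9 Rizzo.primeToThreePart res9Int
  rcases eq_or_ne x 0 with h0 | h0
  · subst h0; simp
  · have hk := padicValRat_three_intCast_of_exactPow (h.resolve_left h0)
    have hdvd : ((3 ^ k : ℤ) : ℤ) ∣ x := dvd_of_exactPow (h.resolve_left h0)
    have hq : (x : ℚ) / 3 ^ padicValRat 3 (x : ℚ) = ((x / 3 ^ k : ℤ) : ℚ) := by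
      rw [hk, zpow_natCast, Int.cast_div hdvd (by positivity)]
      push_cast
      rfl
    simp only [hq, Rat.den_intCast, ↓reduceIte, Rat.num_intCast]

/-- **Table II at integer invariants**: for integers `c₄, c₆, Δ` with `3^{k_Δ} ∥ Δ` and
`3^{k₄} ∥ c₄` (or `c₄ = 0`), `3^{k₆} ∥ c₆` (or `c₆ = 0`),
`Rizzo.ofInvariants c₄ c₆ Δ = tableIIOfInt c₄ c₆ Δ k₄ k₆ k_Δ`.
[cite: Rizzo2003, §1.1–1.2 (pp. 3–4) and Table II (p. 4)] -/
theorem ofInvariants_intCast (c₄ c₆ Δ : ℤ) (k₄ k₆ kΔ : ℕ) (h₄ : c₄ = 0 ∨ exactPow 3 k₄ c₄ = true)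
    (h₆ : c₆ = 0 ∨ exactPow 3 k₆ c₆ = true) (hΔ : exactPow 3 kΔ Δ = true) :
    Rizzo.ofInvariants (c₄ : ℚ) (c₆ : ℚ) (Δ : ℚ) = tableIIOfInt c₄ c₆ Δ k₄ k₆ kΔ := by
  unfold Rizzo.ofInvariants tableIIOfInt
  simp only [padicValRat_three_intCast_of_exactPow hΔ, val3_intCast h₄, val3_intCast h₆,
    res9_intCast h₄, res9_intCast h₆, res9_intCast (Or.inr hΔ)]

/-- `W₃` at integer invariants: `Rizzo.w3OfInvariants c₄ c₆ Δ = w3OfInt c₄ c₆ Δ k₄ k₆ k_Δ`.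
[cite: Rizzo2003, Table II (p. 4), column W₃] -/
theorem w3OfInvariants_intCast (c₄ c₆ Δ : ℤ) (k₄ k₆ kΔ : ℕ) (h₄ : c₄ = 0 ∨ exactPow 3 k₄ c₄ = true)
    (h₆ : c₆ = 0 ∨ exactPow 3 k₆ c₆ = true) (hΔ : exactPow 3 kΔ Δ = true) :
    Rizzo.w3OfInvariants (c₄ : ℚ) (c₆ : ℚ) (Δ : ℚ) = w3OfInt c₄ c₆ Δ k₄ k₆ kΔ := by
  unfold Rizzo.w3OfInvariants w3OfInt
  rw [ofInvariants_intCast c₄ c₆ Δ k₄ k₆ kΔ h₄ h₆ hΔ]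

/-- `v₃(N)` (Table II) at integer invariants:
`Rizzo.condExpOfInvariants c₄ c₆ Δ = condExp3OfInt c₄ c₆ Δ k₄ k₆ k_Δ`.
[cite: Rizzo2003, Table II (p. 4), column v(N)] -/
theorem condExpOfInvariants_intCast (c₄ c₆ Δ : ℤ) (k₄ k₆ kΔ : ℕ)
    (h₄ : c₄ = 0 ∨ exactPow 3 k₄ c₄ = true) (h₆ : c₆ = 0 ∨ exactPow 3 k₆ c₆ = true)
    (hΔ : exactPow 3 kΔ Δ = true) :
    Rizzo.condExpOfInvariants (c₄ : ℚ) (c₆ : ℚ) (Δ : ℚ) = condExp3OfInt c₄ c₆ Δ k₄ k₆ kΔ := by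
  unfold Rizzo.condExpOfInvariants condExp3OfInt
  rw [ofInvariants_intCast c₄ c₆ Δ k₄ k₆ kΔ h₄ h₆ hΔ]

/-! ### The factors of the named fact `rootNumber_eq_neg_finprod_fullTableLocalRootNumberAt` -/

/-- The full-table local root number at the place over `p`: the `ℚ₂` table value at `p = 2`, the
Table II value at `p = 3`, Rohrlich's value elsewhere. [cite: Rizzo2003, §1 Fact 3 (pp. 2–3)] -/
theorem fullTableLocalRootNumberAt_eq_ite (W : WeierstrassCurve ℚ) (v : HeightOneSpectrum ℤ) :
    W.fullTableLocalRootNumberAt v =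
      if natGenerator v = 2 then W.rootNumberTwo'
      else if natGenerator v = 3 then W.rootNumberThree else W.localRootNumberAt v := by
  unfold WeierstrassCurve.fullTableLocalRootNumberAt
  rw [ringChar_quot_eq]

section IntModel

variable {W₀ : WeierstrassCurve ℤ}

/-- **The finite product of the named fact as a list product over `2`, `3` and the bad primes**: for
a duplicate-free list `L` of primes containing `2`, `3` and every prime factor of `Δ(W₀)`,
`∏ᶠ_v W.fullTableLocalRootNumberAt v = ∏_{p ∈ L} W.fullTableLocalRootNumberAt (natPlace p)`
(`w_v = 1` at the good places away from `2, 3`). [cite: Rizzo2003, §1 (p. 2) and Fact 3] -/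
theorem finprod_fullTableLocalRootNumberAt_eq_prod (L : List ℕ) (hL : L.Nodup) (h2 : 2 ∈ L)
    (h3 : 3 ∈ L) (hprime : ∀ p ∈ L, p.Prime)
    (hcover : ∀ p : ℕ, p.Prime → (p : ℤ) ∣ W₀.Δ → p ∈ L) :
    ∏ᶠ v, (W₀.baseChange ℚ).fullTableLocalRootNumberAt v =
      (L.map fun p => (W₀.baseChange ℚ).fullTableLocalRootNumberAt (natPlace p)).prod := by
  refine finprod_eq_prod_map_natPlace _ L hL hprime fun v hv ↦ ?_
  have h2' : natGenerator v ≠ 2 := fun h ↦ hv (h ▸ h2)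
  have h3' : natGenerator v ≠ 3 := fun h ↦ hv (h ▸ h3)
  have hΔ : ¬ (natGenerator v : ℤ) ∣ W₀.Δ := fun h ↦ hv (hcover _ (prime_natGenerator v) h)
  rw [fullTableLocalRootNumberAt_eq_ite, if_neg h2', if_neg h3', localRootNumberAt_eq_one_of_not_dvd hΔ]

end IntModel

/-! ### Root-number certificates with the place `3` -/

/-- The local check at a prime `p ≥ 5` of bad reduction: kinds `0, 1, 2` as `OddEntry.check`
(with `p ≠ 3`), and kind `3`: additive with `c₄ = 0` (`j = 0`), `pᵉ ∥ Δ` with `1 ≤ e < 12`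
(minimality at `p`). [folklore] -/
def OddEntry.check3 (W₀ : WeierstrassCurve ℤ) (E : OddEntry) : Bool :=
  if E.kind = 3 then
    GoldbachLinnik.primeCert E.p (E.s + 1) && decide (5 ≤ E.p) && decide (1 ≤ E.e) &&
      exactPow E.p E.e W₀.Δ && decide (W₀.c₄ = 0) && decide (E.e < 12)
  else E.check W₀ && decide (E.p ≠ 3)

/-- The certified local root number at the entry's prime: as `OddEntry.value` for kinds `0, 1, 2`;
`rohrlichSign p e none` (Rohrlich's formula with `ord_p c₄ = ∞`) for kind `3`.
[cite: Rohrlich1993Compositio, Prop. 2] -/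
def OddEntry.value3 (E : OddEntry) : ℤ :=
  if E.kind = 3 then rohrlichSign E.p E.e none else E.value

/-- A root-number certificate WITH THE PLACE `3` of an integer equation: the `2`-adic and `3`-adic
valuations of `Δ, c₄, c₆` and one `OddEntry` per prime `p ≥ 5` dividing `Δ`. [folklore] -/
structure RNCert3 where
  /-- `v₂(Δ)` -/
  k2 : ℕ
  /-- `v₂(c₄)` (ignored if `c₄ = 0`) -/
  k4 : ℕ
  /-- `v₂(c₆)` (ignored if `c₆ = 0`) -/
  k6 : ℕ
  /-- `v₃(Δ)` -/
  j : ℕ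
  /-- `v₃(c₄)` (ignored if `c₄ = 0`) -/
  j4 : ℕ
  /-- `v₃(c₆)` (ignored if `c₆ = 0`) -/
  j6 : ℕ
  /-- the primes `p ≥ 5` of bad reduction -/
  odd : List OddEntry
  deriving DecidableEq

/-- The certificate check (kernel-decidable): the `2`- and `3`-adic valuations are exact, the primes
`≥ 5` are distinct primes each passing its local check, and `|Δ| = 2^{k2} 3^{j} ∏ p^{e}` (no other
bad prime). [folklore] -/
def RNCert3.check (W₀ : WeierstrassCurve ℤ) (c : RNCert3) : Bool :=
  exactPow 2 c.k2 W₀.Δ && (decide (W₀.c₄ = 0) || exactPow 2 c.k4 W₀.c₄) &&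
    (decide (W₀.c₆ = 0) || exactPow 2 c.k6 W₀.c₆) &&
    exactPow 3 c.j W₀.Δ && (decide (W₀.c₄ = 0) || exactPow 3 c.j4 W₀.c₄) &&
    (decide (W₀.c₆ = 0) || exactPow 3 c.j6 W₀.c₆) &&
    decide ((c.odd.map OddEntry.p).Nodup) && c.odd.all (OddEntry.check3 W₀) &&
    decide (W₀.Δ.natAbs = 2 ^ c.k2 * 3 ^ c.j * (c.odd.map fun E => E.p ^ E.e).prod)

/-- The certified value of `∏ᵥ W.fullTableLocalRootNumberAt v`: the `ℚ₂` table value times (the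
Table II value times the local signs at the primes `≥ 5`). [folklore] -/
def RNCert3.sign (W₀ : WeierstrassCurve ℤ) (c : RNCert3) : ℤ :=
  w2OfInt W₀.c₄ W₀.c₆ W₀.Δ c.k4 c.k6 c.k2 *
    (w3OfInt W₀.c₄ W₀.c₆ W₀.Δ c.j4 c.j6 c.j * (c.odd.map OddEntry.value3).prod)

section Soundness

variable {W₀ : WeierstrassCurve ℤ} {c : RNCert3}

/-- Unpacking a checking certificate. [folklore] -/
theorem RNCert3.check_spec (hc : c.check W₀ = true) :
    exactPow 2 c.k2 W₀.Δ = true ∧ (W₀.c₄ = 0 ∨ exactPow 2 c.k4 W₀.c₄ = true) ∧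
      (W₀.c₆ = 0 ∨ exactPow 2 c.k6 W₀.c₆ = true) ∧
      exactPow 3 c.j W₀.Δ = true ∧ (W₀.c₄ = 0 ∨ exactPow 3 c.j4 W₀.c₄ = true) ∧
      (W₀.c₆ = 0 ∨ exactPow 3 c.j6 W₀.c₆ = true) ∧ (c.odd.map OddEntry.p).Nodup ∧
      (∀ E ∈ c.odd, E.check3 W₀ = true) ∧
      W₀.Δ.natAbs = 2 ^ c.k2 * 3 ^ c.j * (c.odd.map fun E => E.p ^ E.e).prod := by
  simp only [RNCert3.check, Bool.and_eq_true, Bool.or_eq_true, decide_eq_true_eq,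
    List.all_eq_true] at hc
  tauto

/-- Unpacking an entry check. [folklore] -/
theorem OddEntry.check3_spec {E : OddEntry} (h : E.check3 W₀ = true) :
    E.p.Prime ∧ E.p ≠ 2 ∧ E.p ≠ 3 ∧ 1 ≤ E.e ∧
      (E.kind = 3 → 5 ≤ E.p ∧ exactPow E.p E.e W₀.Δ = true ∧ W₀.c₄ = 0 ∧ E.e < 12) ∧
      (E.kind ≠ 3 → E.check W₀ = true) := by
  unfold OddEntry.check3 at h
  by_cases h3 : E.kind = 3
  · simp only [h3, ↓reduceIte, Bool.and_eq_true, decide_eq_true_eq] at h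
    obtain ⟨⟨⟨⟨⟨hpc, h5⟩, he⟩, hex⟩, hc4⟩, hlt⟩ := h
    exact ⟨GoldbachLinnik.prime_of_primeCert hpc, by omega, by omega, he,
      fun _ ↦ ⟨h5, hex, hc4, hlt⟩, fun h' ↦ absurd h3 h'⟩
  · simp only [h3, ↓reduceIte, Bool.and_eq_true, decide_eq_true_eq] at h
    obtain ⟨hp, hp2, he, -⟩ := OddEntry.check_spec h.1
    exact ⟨hp, hp2, h.2, he, fun h' ↦ absurd h' h3, fun _ ↦ h.1⟩

/-- Every prime factor of `Δ` is `2`, `3` or listed. [folklore] -/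
theorem mem_of_prime_dvd3 (hc : c.check W₀ = true) {p : ℕ} (hp : p.Prime)
    (hpd : (p : ℤ) ∣ W₀.Δ) : p ∈ 2 :: 3 :: c.odd.map OddEntry.p := by
  obtain ⟨-, -, -, -, -, -, -, hall, hfac⟩ := RNCert3.check_spec hc
  have h1 : p ∣ W₀.Δ.natAbs := Int.natCast_dvd.mp hpd
  rw [hfac] at h1
  rcases (Nat.Prime.dvd_mul hp).mp h1 with h | h
  · rcases (Nat.Prime.dvd_mul hp).mp h with h | h
    · exact List.mem_cons.mpr (Or.inl ((Nat.prime_dvd_prime_iff_eq hp Nat.prime_two).mp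
        (hp.dvd_of_dvd_pow h)))
    · exact List.mem_cons.mpr (Or.inr (List.mem_cons.mpr (Or.inl
        ((Nat.prime_dvd_prime_iff_eq hp Nat.prime_three).mp (hp.dvd_of_dvd_pow h)))))
  · obtain ⟨a, ha, hpa⟩ := (Prime.dvd_prod_iff hp.prime).mp h
    obtain ⟨E, hE, rfl⟩ := List.mem_map.mp ha
    have hE' := (OddEntry.check3_spec (hall E hE)).1
    refine List.mem_cons.mpr (Or.inr (List.mem_cons.mpr (Or.inr (List.mem_map.mpr ⟨E, hE, ?_⟩))))
    exact ((Nat.prime_dvd_prime_iff_eq hp hE').mp (hp.dvd_of_dvd_pow hpa)).symm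

/-- The local root number at a prime passing `OddEntry.check` (kinds `0, 1, 2`) and dividing `Δ` is
the certified sign (split: a root, `−1`; non-split: Euler witness, `+1`; additive, `p ≥ 5`:
Rohrlich's formula from `ord_p Δ`, `ord_p c₄`) — the entry-level form of
`localRootNumberAt_natPlace_eq_value`. [cite: Rohrlich1993Compositio, Prop. 2] -/
theorem localRootNumberAt_natPlace_eq_value_of_check [(W₀.baseChange ℚ).IsElliptic] {E : OddEntry}
    (h : E.check W₀ = true) (hΔ : (E.p : ℤ) ∣ W₀.Δ) :
    (W₀.baseChange ℚ).localRootNumberAt (natPlace E.p) = E.value := by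
  obtain ⟨hp, hp2, he, h0, h1, h2⟩ := OddEntry.check_spec h
  have hv : natGenerator (natPlace E.p) = E.p := natGenerator_natPlace hp
  unfold OddEntry.value
  by_cases hk0 : E.kind = 0
  · simp only [hk0, ↓reduceIte]
    have key := pow_eq_neg_one_of_binPowMod hp (h0 hk0).2
    have key' : ∀ q, q = E.p → ((nodalDisc W₀ : ℤ) : ZMod q) ^ (q / 2) = -1 := by
      rintro q rfl; exact key
    exact localRootNumberAt_eq_one_of_pow_eq_neg_one (v := natPlace E.p) (by rw [hv]; exact hΔ)
      (by rw [hv]; exact (h0 hk0).1) (by rw [hv]; exact hp2) (key' _ hv)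
  by_cases hk1 : E.kind = 1
  · simp only [hk1, one_ne_zero, ↓reduceIte]
    exact localRootNumberAt_eq_neg_one_of_root (v := natPlace E.p) (by rw [hv]; exact hΔ)
      (by rw [hv]; exact (h1 hk1).1) (t := E.t) (by rw [hv]; exact (h1 hk1).2)
  · simp only [hk0, hk1, ↓reduceIte]
    obtain ⟨h5, heΔ, hc4, htc, hmin⟩ := h2 hk0 hk1
    have heΔ' := exactPow_spec heΔ
    have htc' := exactPow_spec htc
    rw [← hv] at h5 heΔ' htc' hc4
    rw [localRootNumberAt_eq_rohrlichSign (v := natPlace E.p) h5 he heΔ'.1 heΔ'.2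
      (hmin.imp_right fun h4 h ↦ htc'.2 (dvd_trans (pow_dvd_pow _ (by omega)) h)) hc4
      (some E.t.toNat) (by simp) (by rintro k ⟨rfl⟩; exact htc'), hv]

/-- The local root number at a listed prime `p ≥ 5` is the certified sign `value3` (kind `3`:
`c₄ = 0`, Rohrlich's formula from `ord_p Δ` alone). [cite: Rohrlich1993Compositio, Prop. 2] -/
theorem localRootNumberAt_natPlace_eq_value3 [(W₀.baseChange ℚ).IsElliptic] (hc : c.check W₀ = true)
    {E : OddEntry} (hE : E ∈ c.odd) :
    (W₀.baseChange ℚ).localRootNumberAt (natPlace E.p) = E.value3 := by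
  obtain ⟨-, -, -, -, -, -, -, hall, hfac⟩ := RNCert3.check_spec hc
  obtain ⟨hp, hp2, hp3, he, h3, hne3⟩ := OddEntry.check3_spec (hall E hE)
  have hv : natGenerator (natPlace E.p) = E.p := natGenerator_natPlace hp
  have hΔ : (E.p : ℤ) ∣ W₀.Δ := by
    have h1 : E.p ^ E.e ∣ W₀.Δ.natAbs := by
      rw [hfac]
      exact (List.dvd_prod (List.mem_map.mpr ⟨E, hE, rfl⟩)).mul_left _
    exact Int.natCast_dvd.mpr ((dvd_pow_self _ (by omega)).trans h1)
  unfold OddEntry.value3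
  by_cases hk3 : E.kind = 3
  · simp only [hk3, ↓reduceIte]
    obtain ⟨h5, heΔ, hc40, hlt⟩ := h3 hk3
    have heΔ' := exactPow_spec heΔ
    rw [← hv] at h5 heΔ'
    rw [localRootNumberAt_eq_rohrlichSign (v := natPlace E.p) h5 he heΔ'.1 heΔ'.2 (Or.inl hlt)
      (by rw [hc40]; exact dvd_zero _) none (fun _ ↦ hc40) (by rintro k ⟨⟩), hv]
  · simp only [hk3, ↓reduceIte]
    exact localRootNumberAt_natPlace_eq_value_of_check (hne3 hk3) hΔ

/-- **Soundness of root-number certificates with the place `3`**: for a checking certificate,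
`∏ᶠ_v W.fullTableLocalRootNumberAt v = c.sign` (`W = W₀ ⊗ ℚ`): the corrected `ℚ₂` table value at
the place of `2` (`w2OfInvariants'_intCast`), the Table II value at the place of `3`
(`w3OfInvariants_intCast`), the certified signs at the bad primes `≥ 5`, `1` elsewhere.
[cite: Rizzo2003, §1 Fact 3 and Table II (p. 4)] -/
theorem finprod_fullTableLocalRootNumberAt_eq_sign3 (hc : c.check W₀ = true) :
    ∏ᶠ v, (W₀.baseChange ℚ).fullTableLocalRootNumberAt v = c.sign W₀ := by
  obtain ⟨hk2, hk4, hk6, hj, hj4, hj6, hnd, hall, -⟩ := RNCert3.check_spec hc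
  haveI : (W₀.baseChange ℚ).IsElliptic :=
    WeierstrassCurve.isElliptic_baseChange_int _ (ne_zero_of_exactPow hk2)
  have hprime : ∀ p ∈ 2 :: 3 :: c.odd.map OddEntry.p, p.Prime := by
    intro p hp
    rcases List.mem_cons.mp hp with rfl | hp
    · exact Nat.prime_two
    rcases List.mem_cons.mp hp with rfl | h
    · exact Nat.prime_three
    · obtain ⟨E, hE, rfl⟩ := List.mem_map.mp h
      exact (OddEntry.check3_spec (hall E hE)).1
  have hnd' : (2 :: 3 :: c.odd.map OddEntry.p).Nodup := by
    refine List.nodup_cons.mpr ⟨fun h ↦ ?_, List.nodup_cons.mpr ⟨fun h ↦ ?_, hnd⟩⟩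
    · rcases List.mem_cons.mp h with h | h
      · exact absurd h (by decide)
      · obtain ⟨E, hE, hE2⟩ := List.mem_map.mp h
        exact (OddEntry.check3_spec (hall E hE)).2.1 hE2
    · obtain ⟨E, hE, hE3⟩ := List.mem_map.mp h
      exact (OddEntry.check3_spec (hall E hE)).2.2.1 hE3
  have h3mem : 3 ∈ 2 :: 3 :: c.odd.map OddEntry.p := List.mem_cons.mpr (Or.inr List.mem_cons_self)
  rw [finprod_fullTableLocalRootNumberAt_eq_prod (W₀ := W₀) _ hnd' List.mem_cons_self h3mem hprime
    (fun p hp hpd ↦ mem_of_prime_dvd3 hc hp hpd), List.map_cons, List.map_cons, List.prod_cons,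
    List.prod_cons, RNCert3.sign, List.map_map]
  congr 1
  · rw [fullTableLocalRootNumberAt_eq_ite, if_pos (natGenerator_natPlace Nat.prime_two),
      rootNumberTwo'_def, baseChange_int_c₄, baseChange_int_c₆, baseChange_int_Δ]
    exact w2OfInvariants'_intCast _ _ _ _ _ _ hk4 hk6 hk2
  · congr 1
    · rw [fullTableLocalRootNumberAt_eq_ite, natGenerator_natPlace Nat.prime_three, if_neg (by decide),
        if_pos rfl, rootNumberThree_def, baseChange_int_c₄, baseChange_int_c₆, baseChange_int_Δ]
      exact w3OfInvariants_intCast _ _ _ _ _ _ hj4 hj6 hj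
    · congr 1
      refine List.map_congr_left fun E hE ↦ ?_
      obtain ⟨hp, hp2, hp3, -⟩ := OddEntry.check3_spec (hall E hE)
      rw [Function.comp_apply, fullTableLocalRootNumberAt_eq_ite, natGenerator_natPlace hp, if_neg hp2,
        if_neg hp3]
      exact localRootNumberAt_natPlace_eq_value3 hc hE

/-- **The global root number from a certificate with the place `3`, modulo the named fact**: if
`c.check W₀` and the tree's named fact `rootNumber_eq_neg_finprod_fullTableLocalRootNumberAt` (Rizzo
2003 §1 + Table II, row `(≥5,6,9)` corrected; Kellock–Dokchitser's corrected `ℚ₂` table; Rohrlich)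
holds for `W₀ ⊗ ℚ`, then `w(W₀ ⊗ ℚ) = −c.sign`. [cite: Rizzo2003, §1 Fact 3 and Table II (p. 4)] -/
theorem rootNumber_eq_neg_sign3 (hc : c.check W₀ = true)
    (hR : (W₀.baseChange ℚ).rootNumber_eq_neg_finprod_fullTableLocalRootNumberAt) :
    (W₀.baseChange ℚ).rootNumber = -c.sign W₀ := by
  haveI : (W₀.baseChange ℚ).IsElliptic :=
    WeierstrassCurve.isElliptic_baseChange_int _ (ne_zero_of_exactPow (RNCert3.check_spec hc).1)
  rw [← finprod_fullTableLocalRootNumberAt_eq_sign3 hc]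
  exact hR

end Soundness

/-! ### Kernel self-tests: `27747c1` (additive at `3`, row `(2,3,≥6)`: `W₃ = −1`; `3083` split) and
`309123a1 = [0,0,1,0,−27]` (`c₄ = 0`: kind `3` at `107`) -/

example : RNCert3.check ⟨0, 0, 1, -327, 2286⟩ ⟨0, 4, 3, 8, 2, 3, [⟨3083, 55, 1, 1, 1569⟩]⟩ = true ∧
    RNCert3.sign ⟨0, 0, 1, -327, 2286⟩ ⟨0, 4, 3, 8, 2, 3, [⟨3083, 55, 1, 1, 1569⟩]⟩ = 1 := by
  constructor <;> decide +kernel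

example : RNCert3.check ⟨0, 0, 1, 0, -27⟩ ⟨0, 0, 3, 3, 0, 3, [⟨107, 10, 2, 3, 0⟩]⟩ = true ∧
    RNCert3.sign ⟨0, 0, 1, 0, -27⟩ ⟨0, 0, 3, 3, 0, 3, [⟨107, 10, 2, 3, 0⟩]⟩ = 1 := by
  constructor <;> decide +kernel

end Summit.BirchSwinnertonDyer.BirchSwinnertonDyer.Rank2Observatory.RootNumber
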